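import Literature.NumberTheory.EllipticCurves.ClassPolynomialNegForty
import Literature.NumberTheory.EllipticCurves.KleinJCuspExpansionWide
import Mathlib.FieldTheory.Minpoly.IsIntegrallyClosed
import Mathlib.Analysis.Complex.ExponentialBounds
import HarnessLib

/-!
# The class polynomial of discriminant `−24`: `H_{−24}(X) = X² − 4834944·X + 14670139392`, and the
# singular moduli `j(√−6) = 2417472 + 1707264√2`, `j(√−6/2) = 2417472 − 1707264√2`

certified instances and evidence bearing on the general Hodge conjecture; no claim.

Topic `NumberTheory/EllipticCurves` (singular moduli); theorem-only file (no definition, no named fact; D-0026), in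
the tree's vocabulary `classPolynomial D = ∏_{Q ∈ reducedForms D} (X − j(τ_Q))`, `formJ Q = j(τ_Q)`, `τ_Q = heegnerTau Q`.

PRINTED. N. Ishii, *Trace of Frobenius endomorphism of an elliptic curve with complex multiplication*, Bull. Austral.
Math. Soc. 70 (2004) = arXiv:math/0401289, §3, table "The results and data for the case `h(R) = 2`", row `d(R) = −24`
(held text p. 5, lines 41 and 43): "`x² − 4834944x + 14670139392`", "`2417472 + 1707264√2`" (the table of class
equations is M. Kaneko's).

METHOD (OURS) — the `2`-isogeny between the two ideal classes, run inside the kernel; this is the `−40` template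
(`ClassPolynomialNegForty`, whose integer-point lemma `exists_sq_of_G_eq_zero` is REUSED), on the wider cusp disc.
(1) `reducedForms (−24) = {(1,0,6), (2,0,3)}` (Cox Thm. 2.13; `decide`): `H_{−24} = (X − j₁)(X − j₂)`,
`j₁ = j(τ_{(1,0,6)}) = j(i√6)`, `j₂ = j(τ_{(2,0,3)}) = j(i√6/2)`.  (2) The two classes are `2`-ISOGENOUS:
`τ_{(1,0,6)}/2 = τ_{(4,0,6)} = τ_{(2,0,3)}` (the prime above the ramified `2` is the non-principal class), so `j₂` is a
root of the fibre `Φ₂(x, j₁)` (`ModularPolynomialTwo.eval_kleinJ_eq_prod`, Cox (11.14)–(11.15)): `Φ₂(j₂, j₁) = 0` with the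
tree's explicit `Φ₂` (`intModularPolynomial_two_eval`).  (3) SYMMETRIC REDUCTION: `Φ₂(x, y) = G(x + y, xy)`,
`G(s, p) = −p² + (1485s + 41097375)p + s³ − 162000s² + 8748000000s − 157464·10⁹`, and on `G = 0` with `s ≠ −191025`:
`4s + 29025 = m²`, `2p = 1485s + 41097375 + (s + 191025)m`, `m ∈ ℤ` (`ClassPolynomialNegForty.exists_sq_of_G_eq_zero`).
(4) INTEGRALITY: `s = j₁ + j₂`, `p = j₁j₂ ∈ ℤ` because `H_{−24}` is the image of `minpoly_ℤ(j₁)` (tree: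
`minpoly_formJ_map_eq_classPolynomial`, `isIntegral_int_formJ`; Mathlib: `minpoly.isIntegrallyClosed_eq_field_fractions'`).
(5) ONE NUMERIC PIN on the WIDER cusp disc: the nomes at `τ₁ = i√6`, `τ₂ = i√6/2` are the positive reals `e^{−2π√6}`,
`e^{−π√6} ≈ 4.55·10⁻⁴ ≤ 10⁻³` (NOT `≤ 10⁻⁴`), so the wide cusp estimate `|j − 1/q − 744| ≤ 5.25·10⁵|q|`
(`KleinJCuspExpansionWide`) applies at BOTH points and `|s − (E² + E + 1488)| ≤ 239.01`, `E = e^{π√6}`; the kernel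
inequality `2197.9 ≤ e^{π√6} ≤ 2198.1` (`Real.pi_gt_d6`/`pi_lt_d6`, `Real.exp_one_gt_d9`/`lt_d9`, `Real.exp_bound`
with ten Taylor terms — no floating point) gives `4399² < m² < 4403²`, parity gives `|m| = 4401`, so `s = 4834944`;
and `|p| = |j₁||j₂| ≥ (E² + 743.89)(E + 505.1) ≥ 1.3·10¹⁰` excludes `m = −4401` (`p = −7449150177`), so
`p = 14670139392`.  (6) `(2j₁ − s)² = s² − 4p = 2·3414528²` and `|j₁| > 4·10⁶` select `j₁ = 2417472 + 1707264√2`.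

LIMITS. Kernel-checked instance of a printed table row (`H_{−24}` [Ishii2004 §3]) by the `2`-isogeny symmetric-reduction
method (`X₀⁺(2)` parametrisation, integer point `m = 4401`) with a kernel numeric pin on the wider cusp disc; further
level-`2` instance of method class M3, reusing anchor 134's integer-point lemma; theorem-only; no census number changes;
nothing about HC.  References: [Ishii2004] §3; [Cox2013] Thm. 2.13, §11.B (11.14)–(11.15), Thm. 11.1, Thm. 11.18,
§13.A Prop. 13.2; [GranvilleStark2000] §2 (`|1/q| = e^{π√d/a}`).
-/

noncomputable section

open Complex Polynomial
open UpperHalfPlane hiding I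
open scoped Real

namespace Literature.NumberTheory.EllipticCurves

open ModularForms ModularPolynomialTwo
open Literature.NumberTheory.QuadraticFields.BinaryQuadraticForm (reducedForms mem_reducedForms_iff)

namespace ClassPolynomialNegTwentyFour

/-- **The pin on integers**: `m² = 4S + 29025` and `4834211 ≤ S ≤ 4835569` force `S = 4834944` (`4399² < m² <
4403²`, `m` odd); then `m = ±4401` and `|P| ≥ 1.3·10¹⁰` force `P = 14670139392` (`−` would give `−7449150177`). [folklore] -/
private theorem eq_of_window {S P m : ℤ} (hm : m ^ 2 = 4 * S + 29025)
    (hPm : 2 * P - 1485 * S - 41097375 = (S + 191025) * m)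
    (hlo : 4834211 ≤ S) (hhi : S ≤ 4835569) (hP : 13 * 10 ^ 9 ≤ |P|) :
    S = 4834944 ∧ P = 14670139392 := by
  have h1 : |(4399 : ℤ)| < |m| := sq_lt_sq.mp (by nlinarith)
  have h2 : |m| < |(4403 : ℤ)| := sq_lt_sq.mp (by nlinarith)
  rw [abs_of_pos (by norm_num : (0 : ℤ) < 4399)] at h1; rw [abs_of_pos (by norm_num : (0 : ℤ) < 4403)] at h2
  obtain ⟨k, hk⟩ : ∃ k : ℤ, |m| = k := ⟨_, rfl⟩
  have hk2 : k ^ 2 = 4 * S + 29025 := by rw [← hk, sq_abs, hm]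
  rw [hk] at h1 h2
  have hS : S = 4834944 := by interval_cases k <;> omega
  refine ⟨hS, ?_⟩
  subst hS
  have hk5 : k = 4401 := by nlinarith
  rcases (abs_eq (by norm_num : (0 : ℤ) ≤ 4401)).mp (hk.trans hk5) with h | h
  · subst h; omega
  · subst h
    have hP' : P = -7449150177 := by omega
    rw [hP'] at hP
    norm_num at hP

/-- `τ₁/2 = τ_{(4,0,6)} = τ_{(2,0,3)} = τ₂`: the two classes of discriminant `−24` are `2`-isogenous.
[cite: Cox2013, §11.B (11.14)–(11.15)] -/
theorem divPoint_two_zero_heegnerTau_one_zero_six : divPoint 2 0 (heegnerTau (1, 0, 6)) = heegnerTau (2, 0, 3) := by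
  have h := divPoint_two_zero_heegnerTau (a := 1) (b := 0) (c := 6) one_pos (by norm_num)
  norm_num at h
  rw [h]
  apply UpperHalfPlane.ext
  rw [coe_heegnerTau_eq (Q := ((4 : ℤ), (0 : ℤ), (6 : ℤ))) (D := 4 * (-24)) (by norm_num) (by norm_num) (by norm_num),
    coe_heegnerTau_eq (Q := ((2 : ℤ), (0 : ℤ), (3 : ℤ))) (D := -24) (by norm_num) (by norm_num) (by norm_num),
    sqrtDisc_four_mul]
  push_cast
  ring

/-- **`Φ₂(j₂, j₁) = 0` in symmetric form: `G(j₁ + j₂, j₁j₂) = 0`** for `j₁ = j(τ_{(1,0,6)})`, `j₂ = j(τ_{(2,0,3)})`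
(`j₂ = j(τ₁/2)` is a root of the fibre of `Φ₂` over `j₁`; `Φ₂(x, y) = G(x + y, xy)` by `ring`). [cite: Cox2013, §11.B (11.14)–(11.15)] -/
theorem G_formJ_eq_zero :
    -(formJ (1, 0, 6) * formJ (2, 0, 3)) ^ 2 +
        (1485 * (formJ (1, 0, 6) + formJ (2, 0, 3)) + 41097375) * (formJ (1, 0, 6) * formJ (2, 0, 3)) +
        (formJ (1, 0, 6) + formJ (2, 0, 3)) ^ 3 - 162000 * (formJ (1, 0, 6) + formJ (2, 0, 3)) ^ 2 +
        8748000000 * (formJ (1, 0, 6) + formJ (2, 0, 3)) - 157464000000000 = 0 := by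
  have h := eval_kleinJ_eq_prod (formJ (2, 0, 3)) (heegnerTau (1, 0, 6))
  rw [intModularPolynomial_two_eval, divPoint_two_zero_heegnerTau_one_zero_six,
    ← formJ_eq_kleinJ (2, 0, 3), ← formJ_eq_kleinJ (1, 0, 6), sub_self, zero_mul, mul_zero] at h
  linear_combination h

/-- `√(−(−24)) = 2√6` in `ℝ`. [folklore] -/
private theorem sqrt_twentyFour : Real.sqrt (-((-24 : ℤ) : ℝ)) = 2 * √(6 : ℝ) := by
  rw [show (-((-24 : ℤ) : ℝ)) = 2 ^ 2 * 6 by norm_num, Real.sqrt_mul (by norm_num), Real.sqrt_sq (by norm_num)]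

/-- **The nome at `τ₂ = τ_{(2,0,3)} = i√6/2` is the positive real `e^{−π√6}`.**
[cite: GranvilleStark2000, §2 proof of Theorem 1 (`|1/q| = e^{π√d/a}`, here `a = 2`)] -/
theorem qParam_heegnerTau_two_zero_three :
    Function.Periodic.qParam 1 (heegnerTau (2, 0, 3) : ℂ) = (Real.exp (-(π * √(6 : ℝ))) : ℂ) := by
  rw [qParam_one_eq_cexp, Complex.ofReal_exp,
    coe_heegnerTau_eq (Q := ((2 : ℤ), (0 : ℤ), (3 : ℤ))) (D := -24) (by norm_num) (by norm_num) (by norm_num),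
    sqrtDisc, sqrt_twentyFour]
  congr 1
  push_cast
  linear_combination (π * (√(6 : ℝ) : ℂ)) * Complex.I_mul_I

/-- **The nome at `τ₁ = τ_{(1,0,6)} = i√6` is the positive real `e^{−2π√6} = (e^{−π√6})²`.**
[cite: GranvilleStark2000, §2 proof of Theorem 1 (`|1/q| = e^{π√d}`)] -/
theorem qParam_heegnerTau_one_zero_six :
    Function.Periodic.qParam 1 (heegnerTau (1, 0, 6) : ℂ) = (Real.exp (-(π * √(6 : ℝ))) ^ 2 : ℂ) := by
  rw [qParam_one_eq_cexp, ← Complex.ofReal_pow, ← Real.exp_nat_mul, Complex.ofReal_exp,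
    coe_heegnerTau_eq (Q := ((1 : ℤ), (0 : ℤ), (6 : ℤ))) (D := -24) (by norm_num) (by norm_num) (by norm_num),
    sqrtDisc, sqrt_twentyFour]
  congr 1
  push_cast
  linear_combination (2 * π * (√(6 : ℝ) : ℂ)) * Complex.I_mul_I

/-- **The numeric pin: `2197.9 ≤ e^{π√6} ≤ 2198.1`** (true value `2197.9908…`) — a kernel inequality from Mathlib's
certified bounds only: `Real.pi_gt_d6`/`pi_lt_d6` and `2.4494897 < √6 < 2.4494898` give `7.695297 ≤ π√6 ≤ 7.6953001`;
`e^{7.6953x} = (e¹)⁷·e^{0.6953x}` with `Real.exp_one_gt_d9`/`lt_d9` and ten Taylor terms (`Real.exp_bound`). [folklore] -/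
private theorem exp_pi_sqrt_six_bounds : (2197.9 : ℝ) ≤ Real.exp (π * √(6 : ℝ)) ∧ Real.exp (π * √(6 : ℝ)) ≤ 2198.1 := by
  have hs1 : (2.4494897 : ℝ) < √(6 : ℝ) := (Real.lt_sqrt (by norm_num)).mpr (by norm_num)
  have hs2 : √(6 : ℝ) < 2.4494898 := (Real.sqrt_lt' (by norm_num)).mpr (by norm_num)
  have hπ1 : (3.141592 : ℝ) < π := Real.pi_gt_d6
  have hπ2 : π < 3.141593 := Real.pi_lt_d6
  have hx1 : (7.695297 : ℝ) ≤ π * √(6 : ℝ) := by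
    nlinarith [mul_nonneg (sub_nonneg.mpr hπ1.le) (sub_nonneg.mpr hs1.le)]
  have hx2 : π * √(6 : ℝ) ≤ 7.6953001 := by
    nlinarith [mul_nonneg (sub_nonneg.mpr hπ2.le) (sub_nonneg.mpr hs2.le)]
  have he1 : (2.7182818283 : ℝ) < Real.exp 1 := Real.exp_one_gt_d9
  have he2 : Real.exp 1 < (2.7182818286 : ℝ) := Real.exp_one_lt_d9
  have h7pos := pow_pos (Real.exp_pos (1 : ℝ)) 7
  constructor
  · refine le_trans ?_ (Real.exp_le_exp.mpr hx1)
    have hsplit : Real.exp (7.695297 : ℝ) = Real.exp 1 ^ 7 * Real.exp (0.695297 : ℝ) := by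
      rw [← Real.exp_nat_mul, ← Real.exp_add]; norm_num
    have hy : |(0.695297 : ℝ)| ≤ 1 := by rw [abs_of_pos (by norm_num)]; norm_num
    have hT := Real.exp_bound hy (n := 10) (by norm_num)
    simp only [Finset.sum_range_succ, Finset.sum_range_zero, Nat.factorial, Nat.succ_eq_add_one] at hT
    norm_num at hT
    have hlow := (abs_sub_le_iff.1 hT).2
    have h7 : (2.7182818283 : ℝ) ^ 7 ≤ Real.exp 1 ^ 7 := pow_le_pow_left₀ (by norm_num) he1.le 7
    rw [hsplit]
    nlinarith [Real.exp_pos (0.695297 : ℝ)]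
  · refine le_trans (Real.exp_le_exp.mpr hx2) ?_
    have hsplit : Real.exp (7.6953001 : ℝ) = Real.exp 1 ^ 7 * Real.exp (0.6953001 : ℝ) := by
      rw [← Real.exp_nat_mul, ← Real.exp_add]; norm_num
    have hy : |(0.6953001 : ℝ)| ≤ 1 := by rw [abs_of_pos (by norm_num)]; norm_num
    have hT := Real.exp_bound hy (n := 10) (by norm_num)
    simp only [Finset.sum_range_succ, Finset.sum_range_zero, Nat.factorial, Nat.succ_eq_add_one] at hT
    norm_num at hT
    have hup := (abs_sub_le_iff.1 hT).1
    have h7 : Real.exp 1 ^ 7 ≤ (2.7182818286 : ℝ) ^ 7 := pow_le_pow_left₀ (Real.exp_pos _).le he2.le 7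
    rw [hsplit]
    nlinarith [Real.exp_pos (0.6953001 : ℝ)]

/-- **`|j(i√6/2) − e^{π√6} − 744| ≤ 5.25·10⁵·e^{−π√6}`**: the WIDE first-order cusp estimate at `τ₂ = i√6/2`
(`q = e^{−π√6} ≈ 4.55·10⁻⁴ ≤ 10⁻³`, outside the tree's `10⁻⁴` disc). [cite: GranvilleStark2000, §2 proof of Theorem 1] -/
theorem norm_formJ_two_zero_three_sub_le :
    ‖formJ (2, 0, 3) - (Real.exp (π * √(6 : ℝ)) : ℂ) - 744‖ ≤ 525000 * Real.exp (-(π * √(6 : ℝ))) := by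
  have hq := qParam_heegnerTau_two_zero_three
  have hqn : ‖Function.Periodic.qParam 1 (heegnerTau (2, 0, 3) : ℂ)‖ = Real.exp (-(π * √(6 : ℝ))) := by
    rw [hq, Complex.norm_real, Real.norm_eq_abs, abs_of_pos (Real.exp_pos _)]
  have hq3 : ‖Function.Periodic.qParam 1 (heegnerTau (2, 0, 3) : ℂ)‖ ≤ 1 / 10 ^ 3 := by
    rw [hqn, Real.exp_neg, inv_le_comm₀ (Real.exp_pos _) (by norm_num)]
    have : (1 / (10 : ℝ) ^ 3)⁻¹ = 10 ^ 3 := by norm_num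
    rw [this]; linarith [exp_pi_sqrt_six_bounds.1]
  have hj : formJ (2, 0, 3) = ModularForm.E₄ (heegnerTau (2, 0, 3)) ^ 3 / ModularForm.discriminant (heegnerTau (2, 0, 3)) := by
    rw [formJ_eq_kleinJ]; rfl
  have hcusp := norm_E₄_cube_div_discriminant_sub_sub_le_wide (heegnerTau (2, 0, 3)) hq3
  rw [← hj, hqn, hq, ← Complex.ofReal_inv, Real.exp_neg, inv_inv] at hcusp
  rw [Real.exp_neg]; exact hcusp

/-- **`|j(i√6) − e^{2π√6} − 744| ≤ 5.25·10⁵·e^{−2π√6}`**: the wide cusp estimate at `τ₁ = i√6` (`q = e^{−2π√6}`).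
[cite: GranvilleStark2000, §2 proof of Theorem 1] -/
theorem norm_formJ_one_zero_six_sub_le :
    ‖formJ (1, 0, 6) - (Real.exp (π * √(6 : ℝ)) : ℂ) ^ 2 - 744‖ ≤ 525000 * Real.exp (-(π * √(6 : ℝ))) ^ 2 := by
  have hq := qParam_heegnerTau_one_zero_six
  have hqn : ‖Function.Periodic.qParam 1 (heegnerTau (1, 0, 6) : ℂ)‖ = Real.exp (-(π * √(6 : ℝ))) ^ 2 := by
    rw [hq, ← Complex.ofReal_pow, Complex.norm_real, Real.norm_eq_abs, abs_of_pos (pow_pos (Real.exp_pos _) 2)]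
  have hE := exp_pi_sqrt_six_bounds.1
  have hq3 : ‖Function.Periodic.qParam 1 (heegnerTau (1, 0, 6) : ℂ)‖ ≤ 1 / 10 ^ 3 := by
    rw [hqn, Real.exp_neg, inv_pow, inv_le_comm₀ (pow_pos (Real.exp_pos _) 2) (by norm_num)]
    have : (1 / (10 : ℝ) ^ 3)⁻¹ = 10 ^ 3 := by norm_num
    rw [this]; nlinarith [Real.exp_pos (π * √(6 : ℝ))]
  have hj : formJ (1, 0, 6) = ModularForm.E₄ (heegnerTau (1, 0, 6)) ^ 3 / ModularForm.discriminant (heegnerTau (1, 0, 6)) := by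
    rw [formJ_eq_kleinJ]; rfl
  have hcusp := norm_E₄_cube_div_discriminant_sub_sub_le_wide (heegnerTau (1, 0, 6)) hq3
  rw [← hj, hqn, hq, ← Complex.ofReal_pow, ← Complex.ofReal_inv, ← inv_pow, Real.exp_neg, inv_inv,
    Complex.ofReal_pow] at hcusp
  rw [Real.exp_neg]; exact hcusp

/-- **`|j(i√6)| ≥ e^{2π√6} + 743.89`** (from the window at `τ₁` and `E ≥ 2197.9`). [cite: GranvilleStark2000, §2 proof of Theorem 1] -/
theorem le_norm_formJ_one_zero_six : Real.exp (π * √(6 : ℝ)) ^ 2 + 743.89 ≤ ‖formJ (1, 0, 6)‖ := by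
  have hw := norm_formJ_one_zero_six_sub_le
  obtain ⟨hE1, -⟩ := exp_pi_sqrt_six_bounds
  rw [Real.exp_neg] at hw
  set E := Real.exp (π * √(6 : ℝ))
  have hb : 525000 * E⁻¹ ^ 2 ≤ 0.11 := by
    rw [inv_pow, ← div_eq_mul_inv, div_le_iff₀ (by positivity)]; nlinarith
  have htri : ‖(E : ℂ) ^ 2 + 744‖ ≤ ‖formJ (1, 0, 6)‖ + ‖formJ (1, 0, 6) - (E : ℂ) ^ 2 - 744‖ := by
    have e : (E : ℂ) ^ 2 + 744 = formJ (1, 0, 6) - (formJ (1, 0, 6) - (E : ℂ) ^ 2 - 744) := by ring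
    rw [e]; exact norm_sub_le _ _
  have hval : ‖(E : ℂ) ^ 2 + 744‖ = E ^ 2 + 744 := by
    rw [show (E : ℂ) ^ 2 + 744 = ((E ^ 2 + 744 : ℝ) : ℂ) by push_cast; ring, Complex.norm_real, Real.norm_eq_abs,
      abs_of_pos (by positivity)]
  linarith

/-- **`|j(i√6/2)| ≥ e^{π√6} + 505.1`** (from the window at `τ₂` and `E ≥ 2197.9`). [cite: GranvilleStark2000, §2 proof of Theorem 1] -/
theorem le_norm_formJ_two_zero_three : Real.exp (π * √(6 : ℝ)) + 505.1 ≤ ‖formJ (2, 0, 3)‖ := by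
  have hw := norm_formJ_two_zero_three_sub_le
  obtain ⟨hE1, -⟩ := exp_pi_sqrt_six_bounds
  rw [Real.exp_neg] at hw
  set E := Real.exp (π * √(6 : ℝ))
  have hb : 525000 * E⁻¹ ≤ 238.9 := by rw [← div_eq_mul_inv, div_le_iff₀ (Real.exp_pos _)]; nlinarith
  have htri : ‖(E : ℂ) + 744‖ ≤ ‖formJ (2, 0, 3)‖ + ‖formJ (2, 0, 3) - (E : ℂ) - 744‖ := by
    have e : (E : ℂ) + 744 = formJ (2, 0, 3) - (formJ (2, 0, 3) - (E : ℂ) - 744) := by ring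
    rw [e]; exact norm_sub_le _ _
  have hval : ‖(E : ℂ) + 744‖ = E + 744 := by
    rw [show (E : ℂ) + 744 = ((E + 744 : ℝ) : ℂ) by push_cast; ring, Complex.norm_real, Real.norm_eq_abs,
      abs_of_pos (by positivity)]
  linarith

/-- `reducedForms (−24) = {(1,0,6), (2,0,3)}` (`h(−24) = 2`). [cite: Cox2013, Thm. 2.13] -/
theorem reducedForms_neg_twentyFour : reducedForms (-24) = {((1 : ℤ), (0 : ℤ), (6 : ℤ)), (2, 0, 3)} := by
  decide

/-- **`H_{−24}` is the image in `ℂ[X]` of `minpoly_ℤ(j(i√6))`** (the class polynomial has integer coefficients: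
Cox Prop. 13.2 with Thm. 11.1 (i), and `ℤ` integrally closed). [cite: Cox2013, §13.A Prop. 13.2 (with Thm. 11.1 (i))] -/
theorem classPolynomial_neg_twentyFour_eq_map_minpoly_int :
    classPolynomial (-24) = (minpoly ℤ (formJ (1, 0, 6))).map (algebraMap ℤ ℂ) := by
  have hQ : ((1 : ℤ), (0 : ℤ), (6 : ℤ)) ∈ reducedForms (-24) := by rw [reducedForms_neg_twentyFour]; simp
  have hD : (-24 : ℤ) < 0 := by norm_num
  obtain ⟨hdQ, hQ1, hQprim, -⟩ := (mem_reducedForms_iff hD).1 hQ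
  have hint : IsIntegral ℤ (formJ (1, 0, 6)) := isIntegral_int_formJ hQ1 hQprim (by rw [hdQ]; exact hD)
  rw [← minpoly_formJ_map_eq_classPolynomial hD hQ, minpoly.isIntegrallyClosed_eq_field_fractions' ℚ hint,
    Polynomial.map_map]
  congr 1

/-- **`j₁ + j₂ ∈ ℤ` and `j₁j₂ ∈ ℤ`**: the coefficients of `H_{−24} = (X − j₁)(X − j₂) ∈ ℤ[X]`. [cite: Cox2013, §13.A Prop. 13.2 (with Thm. 11.1 (i))] -/
theorem exists_int_trace_norm :
    ∃ S P : ℤ, formJ (1, 0, 6) + formJ (2, 0, 3) = S ∧ formJ (1, 0, 6) * formJ (2, 0, 3) = P := by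
  set M := minpoly ℤ (formJ (1, 0, 6)) with hM
  have h := classPolynomial_neg_twentyFour_eq_map_minpoly_int
  rw [classPolynomial, reducedForms_neg_twentyFour, Finset.prod_pair (by decide)] at h
  have hprod : (X - C (formJ (1, 0, 6))) * (X - C (formJ (2, 0, 3))) =
      X ^ 2 - C (formJ (1, 0, 6) + formJ (2, 0, 3)) * X + C (formJ (1, 0, 6) * formJ (2, 0, 3)) := by
    rw [C_add, C_mul]; ring
  rw [hprod] at h
  have h1 := congr_arg (fun p : ℂ[X] => p.coeff 1) h
  have h0 := congr_arg (fun p : ℂ[X] => p.coeff 0) h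
  simp only [coeff_add, coeff_sub, coeff_X_pow, coeff_C_mul, coeff_X, coeff_C, coeff_map, eq_intCast] at h1 h0
  norm_num at h1 h0
  refine ⟨-(M.coeff 1), M.coeff 0, ?_, ?_⟩
  · push_cast; linear_combination -h1
  · exact_mod_cast h0

/-- **Trace and norm: `j₁ + j₂ = 4834944`, `j₁j₂ = 14670139392`** — the coefficients of the printed
`x² − 4834944x + 14670139392`, derived in the kernel by steps 2–5 of the module docstring.
[cite: Ishii2004, §3 (table `h(R) = 2`, row `d(R) = −24`, held text p. 5 line 41)] -/
theorem formJ_add_and_mul :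
    formJ (1, 0, 6) + formJ (2, 0, 3) = 4834944 ∧ formJ (1, 0, 6) * formJ (2, 0, 3) = 14670139392 := by
  obtain ⟨S, P, hS, hP⟩ := exists_int_trace_norm
  have hw1 := norm_formJ_one_zero_six_sub_le
  have hw2 := norm_formJ_two_zero_three_sub_le
  have hn1 := le_norm_formJ_one_zero_six
  have hn2 := le_norm_formJ_two_zero_three
  obtain ⟨hE1, hE2⟩ := exp_pi_sqrt_six_bounds
  rw [Real.exp_neg] at hw1 hw2
  set E := Real.exp (π * √(6 : ℝ)) with hEdef
  have hEpos : 0 < E := Real.exp_pos _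
  have hb1 : 525000 * E⁻¹ ^ 2 ≤ 0.11 := by
    rw [inv_pow, ← div_eq_mul_inv, div_le_iff₀ (by positivity)]; nlinarith
  have hb2 : 525000 * E⁻¹ ≤ 238.9 := by rw [← div_eq_mul_inv, div_le_iff₀ hEpos]; nlinarith
  have htr : ‖((S : ℂ)) - ((E ^ 2 + E + 1488 : ℝ) : ℂ)‖ ≤ 239.01 := by
    have e : (S : ℂ) - ((E ^ 2 + E + 1488 : ℝ) : ℂ) =
        (formJ (1, 0, 6) - (E : ℂ) ^ 2 - 744) + (formJ (2, 0, 3) - (E : ℂ) - 744) := by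
      rw [← hS]; push_cast; ring
    rw [e]
    exact (norm_add_le _ _).trans (by linarith)
  have e : ((S : ℂ)) - ((E ^ 2 + E + 1488 : ℝ) : ℂ) = (((S : ℝ) - (E ^ 2 + E + 1488) : ℝ) : ℂ) := by
    push_cast; ring
  rw [e, Complex.norm_real, Real.norm_eq_abs] at htr
  obtain ⟨hlo', hhi'⟩ := abs_le.mp htr
  have hlo : (4834211 : ℤ) ≤ S := by exact_mod_cast (by nlinarith : (4834211 : ℝ) ≤ S)
  have hhi : S ≤ (4835569 : ℤ) := by exact_mod_cast (by nlinarith : (S : ℝ) ≤ 4835569)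
  have hPabs : (13 * 10 ^ 9 : ℤ) ≤ |P| := by
    have h : (13 * 10 ^ 9 : ℝ) ≤ ‖(P : ℂ)‖ := by
      rw [← hP, norm_mul]
      calc (13 * 10 ^ 9 : ℝ) ≤ (E ^ 2 + 743.89) * (E + 505.1) := by nlinarith
        _ ≤ ‖formJ (1, 0, 6)‖ * ‖formJ (2, 0, 3)‖ := mul_le_mul hn1 hn2 (by positivity) (norm_nonneg _)
    rw [Complex.norm_intCast] at h
    exact_mod_cast h
  have hG : -P ^ 2 + (1485 * S + 41097375) * P + S ^ 3 - 162000 * S ^ 2 + 8748000000 * S - 157464000000000 = 0 := by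
    have h := G_formJ_eq_zero
    rw [hS, hP] at h
    exact_mod_cast h
  obtain ⟨m, hm, hPm⟩ := ClassPolynomialNegForty.exists_sq_of_G_eq_zero hG (by omega)
  obtain ⟨rfl, rfl⟩ := eq_of_window hm hPm hlo hhi hPabs
  exact ⟨by exact_mod_cast hS, by exact_mod_cast hP⟩

/-- `(√2)² = 2` in `ℂ`. [folklore] -/
private theorem sqrt_two_sq : ((√(2 : ℝ) : ℝ) : ℂ) ^ 2 = 2 := by
  rw [← Complex.ofReal_pow, Real.sq_sqrt (by norm_num)]; norm_num

/-- **`j(i√6) = 2417472 + 1707264√2`** (Ishii's `j` for `d(R) = −24`): the root of `H_{−24}` of modulus `> 4·10⁶`;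
the conjugate root is `< 3500`. [cite: Ishii2004, §3 (table `h(R) = 2`, row `d(R) = −24`: `2417472 + 1707264√2`, held text p. 5 line 43)] -/
theorem formJ_one_zero_six_eq : formJ (1, 0, 6) = 2417472 + 1707264 * (√(2 : ℝ) : ℂ) := by
  obtain ⟨hs, hp⟩ := formJ_add_and_mul
  have hsq : (2 * formJ (1, 0, 6) - 4834944) ^ 2 = (3414528 * (√(2 : ℝ) : ℂ)) ^ 2 := by
    have hj2 : formJ (2, 0, 3) = 4834944 - formJ (1, 0, 6) := by linear_combination hs
    rw [hj2] at hp
    linear_combination (-4 : ℂ) * hp - 3414528 ^ 2 * sqrt_two_sq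
  rcases sq_eq_sq_iff_eq_or_eq_neg.mp hsq with h | h
  · linear_combination (1 / 2 : ℂ) * h
  · exfalso
    have hj : formJ (1, 0, 6) = ((2417472 - 1707264 * √(2 : ℝ) : ℝ) : ℂ) := by
      push_cast; linear_combination (1 / 2 : ℂ) * h
    have hn : (4 * 10 ^ 6 : ℝ) ≤ ‖formJ (1, 0, 6)‖ := by
      have h1 := le_norm_formJ_one_zero_six
      nlinarith [exp_pi_sqrt_six_bounds.1, Real.exp_pos (π * √(6 : ℝ))]
    rw [hj, Complex.norm_real, Real.norm_eq_abs] at hn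
    have hs1 : (1.414 : ℝ) < √(2 : ℝ) := (Real.lt_sqrt (by norm_num)).mpr (by norm_num)
    have hs2 : √(2 : ℝ) < 1.415 := (Real.sqrt_lt' (by norm_num)).mpr (by norm_num)
    have hlt : |(2417472 - 1707264 * √(2 : ℝ) : ℝ)| < 4 * 10 ^ 6 := by rw [abs_lt]; constructor <;> linarith
    linarith

/-- **`j(i√6/2) = j(τ_{(2,0,3)}) = 2417472 − 1707264√2`** (the conjugate root). [cite: Ishii2004, §3 (table `h(R) = 2`, row `d(R) = −24`)] -/
theorem formJ_two_zero_three_eq : formJ (2, 0, 3) = 2417472 - 1707264 * (√(2 : ℝ) : ℂ) := by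
  linear_combination formJ_add_and_mul.1 - formJ_one_zero_six_eq

end ClassPolynomialNegTwentyFour

open ClassPolynomialNegTwentyFour

/-- **`H_{−24}(X) = X² − 4834944·X + 14670139392`**: the class polynomial of discriminant `−24` (`h(−24) = 2`,
reduced forms `(1,0,6)`, `(2,0,3)`), as a kernel theorem about the tree's
`classPolynomial (−24) = (X − j(τ_{(1,0,6)}))(X − j(τ_{(2,0,3)}))`.
[cite: Ishii2004, §3 (table `h(R) = 2`, row `d(R) = −24`: `x² − 4834944x + 14670139392`, held text p. 5 line 41)] -/
theorem classPolynomial_neg_twentyFour :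
    classPolynomial (-24) = X ^ 2 - C (4834944 : ℂ) * X + C (14670139392 : ℂ) := by
  rw [classPolynomial, reducedForms_neg_twentyFour, Finset.prod_pair (by decide)]
  obtain ⟨hs, hp⟩ := formJ_add_and_mul
  calc (X - C (formJ (1, 0, 6))) * (X - C (formJ (2, 0, 3)))
      = X ^ 2 - C (formJ (1, 0, 6) + formJ (2, 0, 3)) * X + C (formJ (1, 0, 6) * formJ (2, 0, 3)) := by
        rw [C_add, C_mul]; ring
    _ = X ^ 2 - C (4834944 : ℂ) * X + C (14670139392 : ℂ) := by rw [hs, hp]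

/-- `H_{−24}(x) = x² − 4834944x + 14670139392` for every `x ∈ ℂ`. [cite: Ishii2004, §3 (row `d(R) = −24`)] -/
theorem classPolynomial_neg_twentyFour_eval (x : ℂ) :
    (classPolynomial (-24)).eval x = x ^ 2 - 4834944 * x + 14670139392 := by
  rw [classPolynomial_neg_twentyFour]
  simp only [eval_add, eval_sub, eval_mul, eval_pow, eval_X, eval_C]

/-- **`H_{−24}(0) = 14670139392 = 2448³`** (the norm of `j(i√6)` is a cube; `2448 = 2⁴·3²·17`).
[cite: Ishii2004, §3 (row `d(R) = −24`)] -/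
theorem classPolynomial_neg_twentyFour_eval_zero : (classPolynomial (-24)).eval 0 = 2448 ^ 3 := by
  rw [classPolynomial_neg_twentyFour_eval]; norm_num

/-- **`H_{−24}(1728) = 6318342144 = 79488² = (2⁷·3³·23)²`** (the norm of `j(i√6) − 1728` is a square).
[cite: Ishii2004, §3 (row `d(R) = −24`)] -/
theorem classPolynomial_neg_twentyFour_eval_1728 : (classPolynomial (-24)).eval 1728 = 79488 ^ 2 := by
  rw [classPolynomial_neg_twentyFour_eval]; norm_num

/-- **`j(𝒪_K) = 2417472 + 1707264√2` for `K = ℚ(√−6)`**: the `j`-invariant of `𝒪_K = ℤ[√−6]` (the tree's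
`cmPeriodPair (−24)`), via `formJ_principalForm`. [cite: Ishii2004, §3 (row `d(R) = −24`: `2417472 + 1707264√2`)] -/
theorem j_cmPeriodPair_neg_twentyFour : (cmPeriodPair (-24)).j = 2417472 + 1707264 * (√(2 : ℝ) : ℂ) := by
  have hP : Literature.NumberTheory.QuadraticFields.BinaryQuadraticForm.principalForm (-24) =
      ((1 : ℤ), (0 : ℤ), (6 : ℤ)) := by decide
  rw [← formJ_principalForm (D := -24) (by norm_num) (by norm_num), hP, formJ_one_zero_six_eq]

end Literature.NumberTheory.EllipticCurves

end
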